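import Mathlib
import Summits.Ventures.PercRepro2.A3PendantFree
import Summits.Ventures.PercRepro2.LeafPlus

/-!
# (FM) at `v` is the one open object of the leaf rows of both lines: it implies p1's row 2′LEAF at `v`,
and (MEANS-a₃) at the leaf at every weight implies it back
(blind cell PercRepro2, night-1 g31; proofs/NIGHT1-G31.md §4–§5)

p1's leaf step (`LeafStep.Gc_leaf`) writes (HCOV) at a leaf `a₃` at `v` as the Bernstein quadratic
`(1 − q)² T₀ + 2q(1 − q) R½ + q² Gc(v)` with the open row **`LeafRow := 0 ≤ R½`** (2′LEAF, the S3 gap of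
proofs/CRUX-SUBCLAIMS.md).  The middle coefficient is an exact combination of objects of the means line:

  **`2 P(Q) · R½(v) = P(Q)³ · (∑_W slack_W / m_W + FMfun(v)) + D_v · T₀`**   (`two_Q_Rhalf_eq`)

— the fibre slacks of the `v`-exploration (`A3Fibre.slack ≥ 0`, BHK 1.4 / Harris on `G − W`,
`A3FibreA.slack_nonneg`), the first-order functional (FM) at `v` (`FMfun`, A3PendantFree.lean) and the
`a₃`-free BHK term `T₀ ≥ 0` (`LeafStep.T0_nonneg`).  Proof: the per-fibre identity `slack_div_add` summed
cancels the ratio sums of `∑ slack/m_W + FMfun` (`sum_slack_div_add_FMfun`; the centring moves from `γ_v`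
to `γ₀` by `sum_term_SFg_affine`), leaving a polynomial in the `Q`-masses, and `ring` against
`LeafStep.Rhalf`.  Hence **`LeafRow_of_FMfun : 0 ≤ FMfun(v) → LeafRow(v)`** and
**`HCov_leaf_of_FMfun`: (HCOV)(v) ∧ (FM)(v) ⟹ (HCOV) at the leaf** (`LeafStep.HCov_leaf_of`).

Conversely (**`FMfun_nonneg_of_a3Between_leaf`**): if (MEANS-a₃) holds at the leaf for EVERY weight of the
leaf edge (`P(Q) > 0`), then `0 ≤ FMfun(v)` — from `btw_leaf_free`, `btw(a₃)/t = (1 − s_t) btw(v) + s_t FMfun(v)`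
with `s_t → 1` as `t → 0` (the scalar limit `nonneg_of_affine_limit`: `t = δ/(1 + δ)`,
`δ D (|X| + 1) = −Y P(Q)/2`); when `D_v = 0`, `s_t = 1` for every `t < 1`.  So on the pendant-at-`v` class
p5's reduced statement is EQUIVALENT to (MEANS-a₃)(v) ∧ (FM)(v), and (FM)(v) alone closes p1's row
2′LEAF at `v`: the first-order functional at the attachment vertex is the single open object of the
pendant rows of both lines.

Finally the two endpoints of the leaf expansion differ by p1's (Q1)-margin
(**`FMfun_sub_btw_eq`**: `P(Q)³ D_v (FMfun(v) − btw(v)) = CovC(o, v) · T₀(b, v)`, from the three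
identities above), so p1's (Q1)-functional is the fibre slacks plus (FM) (**`Q1fun_eq`**),
**`Q1Row_of_FMfun`**, and (FM) follows from (MEANS-a₃) at `v` whenever `CovC(o, v) ≥ 0`
(`FMfun_nonneg_of_a3Between_of_covC_nonneg`): the new content of (FM) lives exactly where p1 located
the new content of (Q1) — on `CovC(o, v) < 0`.  Standard axioms.
-/

namespace Summit.Ventures.PercRepro2

open UnionCluster CovForm PendantRoot PendantO

namespace CovForm

namespace A3Fibre

/-! ## (FM) at `v` implies p1's leaf row at `v` -/

section Row

variable {V : Type*} {E : Type*} [Fintype V] [DecidableEq V] [Fintype E] [DecidableEq E]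
  {R : Type*} [Field R] [LinearOrder R] [IsStrictOrderedRing R]

omit [LinearOrder R] [IsStrictOrderedRing R] in
/-- `∑_W SFg(0) = ∑ Ssig_o − ∑ s3·Su_o`. -/
lemma sum_SFg_zero (p : E → R) (ends : E → Sym2 V) (o a₁ a₂ v : V) :
    ∑ W : Finset V, RootEdge.SFg p ends o a₁ a₂ v 0 W =
      (∑ W : Finset V, Ssig p ends a₁ a₂ v o W) - ∑ W : Finset V, s3 a₁ a₂ W * Su p ends a₁ a₂ v o W := by
  rw [← Finset.sum_sub_distrib]
  refine Finset.sum_congr rfl fun W _ => ?_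
  unfold RootEdge.SFg
  ring

/-- **The fibre slacks plus (FM) are a mass polynomial**: the ratio sums cancel,
`∑_W slack_W/m_W + FMfun = E_Q[σ_b F⁰] − P(PD_v, b ∈ U, o ∈ U) + gap·E_Q[F⁰]/P(Q) + (n_b m_o + n_o m_b)/P(Q) − D_v m_b m_o/P(Q)²`
with `F⁰ = σ_o + σ_v(γ₀ − U_o)`, `γ₀ = m_o/P(Q)`. -/
lemma sum_slack_div_add_FMfun {p : E → R} (hp : IsProbVec p) (ends : E → Sym2 V) (o a₁ a₂ v b : V) :
    (∑ W : Finset V, slack p ends o a₁ a₂ v b W / mW p ends a₁ a₂ v W) + FMfun p ends o a₁ a₂ v b =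
      (EQbo p ends o a₁ a₂ b + gamma0 p ends o a₁ a₂ * EQb3 p ends a₁ a₂ v b - EQb3o p ends o a₁ a₂ v b) -
        PDbo p ends o a₁ a₂ v b +
        gap p ends a₁ a₂ b *
          (EQo p ends o a₁ a₂ + gamma0 p ends o a₁ a₂ * EQ3 p ends a₁ a₂ v - EQ3o p ends o a₁ a₂ v) /
          prob p (avoidAll ends a₂ {a₁}) +
        (PDb p ends a₁ a₂ v b * LeafStep.mU p ends a₁ a₂ o + Do p ends o a₁ a₂ v * LeafStep.mU p ends a₁ a₂ b) /
          prob p (avoidAll ends a₂ {a₁}) -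
        prob p (PDEvent ends a₁ a₂ v) * LeafStep.mU p ends a₁ a₂ b * LeafStep.mU p ends a₁ a₂ o /
          prob p (avoidAll ends a₂ {a₁}) ^ 2 := by
  -- the per-fibre identity (at the `v`-centring) summed
  have hpf := Finset.sum_congr rfl
    (fun W (_ : W ∈ (Finset.univ : Finset (Finset V))) => slack_div_add hp ends o a₁ a₂ v b W)
  rw [Finset.sum_sub_distrib, Finset.sum_add_distrib, Finset.sum_sub_distrib] at hpf
  -- the centring moved from `γ_v` to `γ₀`
  have haff := sum_term_SFg_affine hp ends o a₁ a₂ v b (gamma0 p ends o a₁ a₂)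
  have haff' := sum_term_SFg_affine hp ends o a₁ a₂ v b (gamma p ends o a₁ a₂ v)
  simp only [RootEdge.SFg_gamma] at haff'
  unfold FMfun
  rw [fibresA, Finset.sum_filter, Finset.sum_filter, Finset.sum_filter, haff,
    sum_SFg_affine p ends o a₁ a₂ v (gamma0 p ends o a₁ a₂), sum_SFg_zero, ← PDb_eq, ← Do_eq,
    ← EQb3_eq, ← EQ3_eq, ← EQ3o_eq, ← EQo_eq p ends o a₁ a₂ v, gap_eq_sum p ends a₁ a₂ v b]
  rw [sum_SbF, ← EQbo_eq, ← EQb3_eq, ← EQb3o_eq, ← PDbo_eq] at hpf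
  rw [← EQb3_eq] at haff'
  linear_combination hpf - haff'

omit [Fintype V] [DecidableEq V] in
/-- When `P(Q) = 0` every `Q`-mass vanishes. -/
lemma prob_Q_inter_eq_zero {p : E → R} (hp : IsProbVec p) (ends : E → Sym2 V) (a₁ a₂ : V)
    (hQ : prob p (avoidAll ends a₂ {a₁}) = 0) (X : Set (Config E)) :
    prob p (avoidAll ends a₂ {a₁} ∩ X) = 0 :=
  le_antisymm (hQ ▸ prob_mono hp Set.inter_subset_left) (prob_nonneg hp _)

/-- **`R½` through (FM)**: `2 P(Q) · R½(v) = P(Q)³ · (∑_W slack_W/m_W + FMfun(v)) + D_v · T₀` — p1's middle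
Bernstein coefficient of the leaf expansion of (HCOV) is the fibre slacks plus (FM) plus the BHK term. -/
theorem two_Q_Rhalf_eq {p : E → R} (hp : IsProbVec p) (ends : E → Sym2 V) (o a₁ a₂ v b : V) :
    2 * prob p (avoidAll ends a₂ {a₁}) * LeafStep.Rhalf p ends o a₁ a₂ v b =
      prob p (avoidAll ends a₂ {a₁}) ^ 3 *
          ((∑ W : Finset V, slack p ends o a₁ a₂ v b W / mW p ends a₁ a₂ v W) +
            FMfun p ends o a₁ a₂ v b) +
        prob p (PDEvent ends a₁ a₂ v) * LeafStep.T0 p ends o a₁ a₂ b := by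
  rw [sum_slack_div_add_FMfun hp ends o a₁ a₂ v b]
  unfold LeafStep.Rhalf LeafStep.Gc1 LeafStep.T0 gamma0
  rw [LeafStep.prob_PD_v p ends a₁ a₂ v]
  unfold LeafStep.mU LeafStep.mUU
  rcases eq_or_ne (prob p (avoidAll ends a₂ {a₁})) 0 with hQ | hQ
  · have hz := prob_Q_inter_eq_zero hp ends a₁ a₂ hQ
    simp only [hz, hQ]
    ring
  · field_simp
    ring

/-- **(FM) at `v` implies p1's leaf row at `v`**: `0 ≤ FMfun p o a₁ a₂ v b → LeafRow p o a₁ a₂ v b`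
(the fibre slacks are `≥ 0` by `slack_nonneg`, `T₀ ≥ 0` by `LeafStep.T0_nonneg`). -/
theorem LeafRow_of_FMfun {p : E → R} (hp : IsProbVec p) (ends : E → Sym2 V) (o a₁ a₂ v b : V)
    (hFM : 0 ≤ FMfun p ends o a₁ a₂ v b) : LeafStep.LeafRow p ends o a₁ a₂ v b := by
  unfold LeafStep.LeafRow
  have hid := two_Q_Rhalf_eq hp ends o a₁ a₂ v b
  have hQ := prob_nonneg hp (avoidAll ends a₂ {a₁})
  have hW : 0 ≤ ∑ W : Finset V, slack p ends o a₁ a₂ v b W / mW p ends a₁ a₂ v W :=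
    Finset.sum_nonneg fun W _ => div_nonneg (slack_nonneg p hp ends o a₁ a₂ v b W) (prob_nonneg hp _)
  have hT := LeafStep.T0_nonneg p ends hp o a₁ a₂ b
  have hD := prob_nonneg hp (PDEvent ends a₁ a₂ v)
  rcases eq_or_ne (prob p (avoidAll ends a₂ {a₁})) 0 with hQ0 | hQ0
  · -- every `Q`-mass vanishes, so `R½ = 0`
    have hz := prob_Q_inter_eq_zero hp ends a₁ a₂ hQ0
    unfold LeafStep.Rhalf LeafStep.Gc1 LeafStep.T0 LeafStep.mU LeafStep.mUU EQo EQ3 EQ3o EQb3 EQb3o EQbo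
      PDb PDbo Do
    rw [LeafStep.prob_T_v, LeafStep.prob_T'_v]
    simp only [LeafStep.prob_T_inter_v, LeafStep.prob_PD_inter_v, hz, hQ0]
    simp
  · have hQpos : 0 < prob p (avoidAll ends a₂ {a₁}) := lt_of_le_of_ne hQ (Ne.symm hQ0)
    have hrhs : 0 ≤ prob p (avoidAll ends a₂ {a₁}) ^ 3 *
          ((∑ W : Finset V, slack p ends o a₁ a₂ v b W / mW p ends a₁ a₂ v W) +
            FMfun p ends o a₁ a₂ v b) +
        prob p (PDEvent ends a₁ a₂ v) * LeafStep.T0 p ends o a₁ a₂ b :=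
      add_nonneg (mul_nonneg (pow_nonneg hQ 3) (add_nonneg hW hFM)) (mul_nonneg hD hT)
    rw [← hid] at hrhs
    have h2Q : 0 < 2 * prob p (avoidAll ends a₂ {a₁}) := by linarith
    exact (mul_nonneg_iff_of_pos_left h2Q).1 hrhs

/-- **(HCOV) at a leaf `a₃` at `v` from (HCOV) at `v` and (FM) at `v`** (p1's `LeafStep.HCov_leaf_of`
with the row supplied by `LeafRow_of_FMfun`). -/
theorem HCov_leaf_of_FMfun {p : E → R} (hp : IsProbVec p) {ends : E → Sym2 V} {f : E} {a₃ v : V}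
    (hf : ends f = s(a₃, v)) (hleaf : ∀ e, a₃ ∈ ends e → e = f) (h3v : a₃ ≠ v) {o a₁ a₂ b : V}
    (h31 : a₃ ≠ a₁) (h32 : a₃ ≠ a₂) (ho : o ≠ a₃) (hb : b ≠ a₃) (hv : HCov p ends o a₁ a₂ v b)
    (hFM : 0 ≤ FMfun p ends o a₁ a₂ v b) : HCov p ends o a₁ a₂ a₃ b :=
  LeafStep.HCov_leaf_of p ends hp hf hleaf h3v h31 h32 ho hb hv (LeafRow_of_FMfun hp ends o a₁ a₂ v b hFM)
    (LeafStep.T0_nonneg p ends hp o a₁ a₂ b)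

end Row

/-! ## The converse: (MEANS-a₃) at the leaf at every weight forces (FM) at `v` -/

section Converse

variable {V : Type*} {E : Type*} [Fintype V] [DecidableEq V] [Fintype E] [DecidableEq E]
  {R : Type*} [Field R] [LinearOrder R] [IsStrictOrderedRing R]
  {ends : E → Sym2 V} {f : E} {a₃ v : V}

omit [Fintype V] [DecidableEq V] [Fintype E] [LinearOrder R] [IsStrictOrderedRing R] in
/-- Pinning the leaf to `t` and then to `1` is pinning it to `1`. -/
lemma update_update_one (p : E → R) (t : R) :
    Function.update (Function.update p f t) f 1 = Function.update p f 1 := by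
  rw [Function.update_idem]

omit [Fintype V] [DecidableEq V] [Fintype E] [DecidableEq E] in
/-- The scalar lemma of the limit `s → 1`: if `(1 − s_t) X + s_t Y ≥ 0` for every admissible `t`, then
`Y ≥ 0` (with `s_t = (1 − t) Q / ((1 − t) Q + t D)`, `Q > 0`, `D > 0`). -/
lemma nonneg_of_affine_limit {X Y Q D : R} (hQ : 0 < Q) (hD : 0 < D)
    (h : ∀ t : R, 0 < t → t < 1 →
      0 ≤ (1 - (1 - t) * Q / ((1 - t) * Q + t * D)) * X + (1 - t) * Q / ((1 - t) * Q + t * D) * Y) :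
    0 ≤ Y := by
  by_contra hY'
  have hY : Y < 0 := not_le.1 hY'
  have hX1 : 0 < |X| + 1 := by positivity
  have hYQ : 0 < -Y * Q / 2 := by
    have := mul_pos (neg_pos.2 hY) hQ
    linarith
  -- `δ · D (|X| + 1) = −Y Q / 2`, `t = δ / (1 + δ)`
  obtain ⟨δ, hδ⟩ : ∃ δ : R, δ = -Y * Q / 2 / (D * (|X| + 1)) := ⟨_, rfl⟩
  have hδD : δ * (D * (|X| + 1)) = -Y * Q / 2 := by
    rw [hδ]
    exact div_mul_cancel₀ _ (by positivity)
  have hδpos : 0 < δ := by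
    rw [hδ]
    exact div_pos hYQ (by positivity)
  obtain ⟨t, ht⟩ : ∃ t : R, t = δ / (1 + δ) := ⟨_, rfl⟩
  have h1δ : 0 < 1 + δ := by linarith
  have ht0 : 0 < t := by rw [ht]; exact div_pos hδpos h1δ
  have ht1 : t < 1 := by
    rw [ht, div_lt_one h1δ]
    linarith
  have h1t : 1 - t = 1 / (1 + δ) := by
    rw [ht]
    field_simp
    ring
  have hden : (1 - t) * Q + t * D = (Q + δ * D) / (1 + δ) := by
    rw [h1t, ht]
    field_simp
  have hQδ : 0 < Q + δ * D := by nlinarith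
  have hs : (1 - t) * Q / ((1 - t) * Q + t * D) = Q / (Q + δ * D) := by
    rw [hden, h1t]
    field_simp
  have hs' : 1 - (1 - t) * Q / ((1 - t) * Q + t * D) = δ * D / (Q + δ * D) := by
    rw [hs]
    field_simp
    ring
  have key := h t ht0 ht1
  rw [hs', hs] at key
  have e : δ * D / (Q + δ * D) * X + Q / (Q + δ * D) * Y = (δ * D * X + Q * Y) / (Q + δ * D) := by
    rw [div_mul_eq_mul_div, div_mul_eq_mul_div, ← add_div]
  rw [e] at key
  have hnum : 0 ≤ δ * D * X + Q * Y :=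
    (div_nonneg_iff.1 key).elim (fun h => h.1) (fun h => by nlinarith [h.2])
  have h1 : δ * D * X ≤ δ * D * |X| :=
    mul_le_mul_of_nonneg_left (le_abs_self X) (by positivity)
  have h2 : δ * D * (|X| + 1) = -Y * Q / 2 := by rw [← hδD]; ring
  have h3 : 0 < δ * D := by positivity
  have h4 : Q * Y < 0 := mul_neg_of_pos_of_neg hQ hY
  nlinarith

/-- **The converse of `A3Between_leaf_free_of`**: if (MEANS-a₃) holds at the leaf `a₃` at `v` for EVERY
weight of the leaf edge, then `0 ≤ FMfun` at `v` (under `p[f ↦ 1]`) — provided `P(Q) > 0` (else everything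
vanishes).  With `btw_leaf_of_pf_eq_one` (the weight `1`), the pendant class of the reduced statement is
EQUIVALENT to (MEANS-a₃)(v) ∧ (FM)(v). -/
theorem FMfun_nonneg_of_a3Between_leaf {p : E → R} (hp : IsProbVec p) (hf : ends f = s(a₃, v))
    (hleaf : ∀ e, a₃ ∈ ends e → e = f) (h3v : a₃ ≠ v) {o a₁ a₂ b : V} (h31 : a₃ ≠ a₁) (h32 : a₃ ≠ a₂)
    (ho : o ≠ a₃) (hb : b ≠ a₃) (hQ : 0 < prob p (avoidAll ends a₂ {a₁}))
    (hall : ∀ t : R, 0 ≤ t → t ≤ 1 → A3Between (Function.update p f t) ends o a₁ a₂ a₃ b) :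
    0 ≤ FMfun (Function.update p f 1) ends o a₁ a₂ v b := by
  have hp₁ : IsProbVec (Function.update p f 1) := hp.update f zero_le_one le_rfl
  -- the data at weight `t`
  have hQt : ∀ t : R, prob (Function.update p f t) (avoidAll ends a₂ {a₁}) =
      prob p (avoidAll ends a₂ {a₁}) := by
    intro t
    have h1 := HMFPendantRoot.prob_update_one_of_free (Function.update p f t)
      (free_Q hf hleaf h3v h31 h32)
    have h2 := HMFPendantRoot.prob_update_one_of_free p (free_Q hf hleaf h3v h31 h32)
    rw [update_update_one] at h1
    rw [← h1, h2]
  have hDt : ∀ t : R, prob (Function.update p f t) (PDEvent ends a₁ a₂ a₃) =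
      (1 - t) * prob p (avoidAll ends a₂ {a₁}) +
        t * prob (Function.update p f 1) (PDEvent ends a₁ a₂ v) := by
    intro t
    rw [prob_PD_leaf_free (Function.update p f t) hf hleaf h3v h31 h32,
      mW_singleton_leaf (Function.update p f t) hf hleaf h3v h31 h32, update_update_one, hQt,
      Function.update_self]
    ring
  have hDv := prob_nonneg hp₁ (PDEvent ends a₁ a₂ v)
  rcases eq_or_lt_of_le hDv with hDv0 | hDvpos
  · -- `D_v = 0`: `s = 1` at every `t < 1`; take `t = 1/2`
    have h := hall (1 / 2) (by norm_num) (by norm_num)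
    unfold A3Between at h
    have hD : prob (Function.update p f (1 / 2)) (PDEvent ends a₁ a₂ a₃) ≠ 0 := by
      rw [hDt, ← hDv0]
      have := hQ
      intro hz
      nlinarith
    rw [btw_leaf_free (hp.update f (by norm_num) (by norm_num)) hf hleaf h3v h31 h32 ho hb hD,
      update_update_one, Function.update_self, hQt, hDt, ← hDv0] at h
    have hs : (1 - (1 / 2 : R)) * prob p (avoidAll ends a₂ {a₁}) /
        ((1 - 1 / 2) * prob p (avoidAll ends a₂ {a₁}) + 1 / 2 * 0) = 1 := by
      rw [mul_zero, add_zero, div_self]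
      exact mul_ne_zero (by norm_num) hQ.ne'
    rw [hs] at h
    linarith
  · -- `D_v > 0`: the limit `s → 1`
    apply nonneg_of_affine_limit hQ hDvpos (X := btw (Function.update p f 1) ends o a₁ a₂ v b)
    intro t ht0 ht1
    have h := hall t ht0.le ht1.le
    unfold A3Between at h
    have hD : prob (Function.update p f t) (PDEvent ends a₁ a₂ a₃) ≠ 0 := by
      rw [hDt]
      have h1t : 0 < 1 - t := by linarith
      positivity
    rw [btw_leaf_free (hp.update f ht0.le ht1.le) hf hleaf h3v h31 h32 ho hb hD, update_update_one,
      Function.update_self, hQt, hDt] at h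
    exact (mul_nonneg_iff_of_pos_left ht0).1 h

end Converse


/-! ## The two endpoints differ by p1's (Q1)-margin: `FMfun(v) − btw(v) = CovC(o, v)·T₀(b, v)/(P(Q)³ D_v)` -/

section Margin

variable {V : Type*} {E : Type*} [Fintype V] [DecidableEq V] [Fintype E] [DecidableEq E]
  {R : Type*} [Field R] [LinearOrder R] [IsStrictOrderedRing R]

/-- **The two endpoints of the leaf expansion differ by p1's margin**:
`P(Q)³ · D_v · (FMfun(v) − btw(v)) = CovC(o, v) · T₀(b, v)` (from `two_Q_Rhalf_eq`, p1's pole identity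
`LeafStep.Rhalf_pole_identity` and p5's `Gc_eq_a3` at `v`).  So (FM)(v) is (MEANS-a₃)(v) shifted by the
cleared covariance of `1_{o∈U}`, `1_{v∈U}` times the BHK term of the pair `(b, v)`: on `CovC(o, v) ≥ 0`
(FM) follows from (MEANS-a₃) at `v`; its new content lives on `CovC(o, v) < 0`, exactly as p1's (Q1). -/
theorem FMfun_sub_btw_eq {p : E → R} (hp : IsProbVec p) (ends : E → Sym2 V) (o a₁ a₂ v b : V) :
    prob p (avoidAll ends a₂ {a₁}) ^ 3 * prob p (PDEvent ends a₁ a₂ v) *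
        (FMfun p ends o a₁ a₂ v b - btw p ends o a₁ a₂ v b) =
      LeafStep.covC p ends o a₁ a₂ v * LeafStep.T0 p ends b a₁ a₂ v := by
  have h1 := two_Q_Rhalf_eq hp ends o a₁ a₂ v b
  have h2 := LeafStep.Rhalf_pole_identity p ends o a₁ a₂ v b
  have h3 := Gc_eq_a3 hp ends o a₁ a₂ v b
  linear_combination -(prob p (PDEvent ends a₁ a₂ v)) * h1 + h2 +
    prob p (avoidAll ends a₂ {a₁}) ^ 2 * h3

/-- **p1's (Q1)-functional is the fibre slacks plus (FM)**:
`P(Q)² · Gc(v) + CovC(o, v) · T₀(b, v) = P(Q)³ · D_v · (∑_W slack_W/m_W + FMfun(v))`. -/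
theorem Q1fun_eq {p : E → R} (hp : IsProbVec p) (ends : E → Sym2 V) (o a₁ a₂ v b : V) :
    prob p (avoidAll ends a₂ {a₁}) ^ 2 * Gc p ends o a₁ a₂ v b +
        LeafStep.covC p ends o a₁ a₂ v * LeafStep.T0 p ends b a₁ a₂ v =
      prob p (avoidAll ends a₂ {a₁}) ^ 3 * prob p (PDEvent ends a₁ a₂ v) *
        ((∑ W : Finset V, slack p ends o a₁ a₂ v b W / mW p ends a₁ a₂ v W) +
          FMfun p ends o a₁ a₂ v b) := by
  have h1 := FMfun_sub_btw_eq hp ends o a₁ a₂ v b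
  have h3 := Gc_eq_a3 hp ends o a₁ a₂ v b
  linear_combination -h1 + prob p (avoidAll ends a₂ {a₁}) ^ 2 * h3

/-- **(FM) at `v` implies p1's row (Q1) at `v`** (`LeafStep.Q1Row`). -/
theorem Q1Row_of_FMfun {p : E → R} (hp : IsProbVec p) (ends : E → Sym2 V) (o a₁ a₂ v b : V)
    (hFM : 0 ≤ FMfun p ends o a₁ a₂ v b) : LeafStep.Q1Row p ends o a₁ a₂ v b := by
  unfold LeafStep.Q1Row
  rw [Q1fun_eq hp ends o a₁ a₂ v b]
  have hW : 0 ≤ ∑ W : Finset V, slack p ends o a₁ a₂ v b W / mW p ends a₁ a₂ v W :=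
    Finset.sum_nonneg fun W _ => div_nonneg (slack_nonneg p hp ends o a₁ a₂ v b W) (prob_nonneg hp _)
  exact mul_nonneg (mul_nonneg (pow_nonneg (prob_nonneg hp _) 3) (prob_nonneg hp _)) (add_nonneg hW hFM)

/-- **(FM) from (MEANS-a₃) at `v` when `CovC(o, v) ≥ 0`** (`P(Q), D_v > 0`): the margin is nonnegative. -/
theorem FMfun_nonneg_of_a3Between_of_covC_nonneg {p : E → R} (hp : IsProbVec p) (ends : E → Sym2 V)
    (o a₁ a₂ v b : V) (hQ : 0 < prob p (avoidAll ends a₂ {a₁})) (hD : 0 < prob p (PDEvent ends a₁ a₂ v))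
    (hC : 0 ≤ LeafStep.covC p ends o a₁ a₂ v) (hv : A3Between p ends o a₁ a₂ v b) :
    0 ≤ FMfun p ends o a₁ a₂ v b := by
  have h := FMfun_sub_btw_eq hp ends o a₁ a₂ v b
  have hT := LeafStep.T0_nonneg p ends hp b a₁ a₂ v
  have hpos : 0 < prob p (avoidAll ends a₂ {a₁}) ^ 3 * prob p (PDEvent ends a₁ a₂ v) :=
    mul_pos (pow_pos hQ 3) hD
  have hdiff : 0 ≤ FMfun p ends o a₁ a₂ v b - btw p ends o a₁ a₂ v b := by
    have : 0 ≤ prob p (avoidAll ends a₂ {a₁}) ^ 3 * prob p (PDEvent ends a₁ a₂ v) *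
        (FMfun p ends o a₁ a₂ v b - btw p ends o a₁ a₂ v b) := by
      rw [h]; exact mul_nonneg hC hT
    exact (mul_nonneg_iff_of_pos_left hpos).1 this
  unfold A3Between at hv
  linarith

end Margin

end A3Fibre

end CovForm

end Summit.Ventures.PercRepro2
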